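import Mathlib
import HarnessLib
import Summits.QuantumFields.QCD.Theses.PauliWegnerSea
import Summits.QuantumFields.QCD.Theses.WilsonMobilityGap

/-!
# Sketch — first lemmas of the crux-idea cards for `ChiralGluonicCompletion` (stmt-QuantumFields-17498)

Planner scratch file (crux-ideate round 1, ideator k = 1). §0 packages the crux clause by clause
(`crux_iff` is `Iff.rfl`, so the packaging is faithful). §1 is the first lemma of card
`parity-reads-intensity` (abstract parity–intensity inequality, PROVED; and its typed application to
clause (iv) under the phase-quenched torus law, stated). §2 records the quantifier geometry of the pin
(card `keep-k-whole`, MERGED after filing into ideator 2's `strongly-chiral-subsequence`): the same-`reg`,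
whole-sequence completion DOES imply the crux (`of_sameRegChiralCompletion`, proved) but its hypothesis
`SameRegChiralCompletion` is FALSE in general — an H-witness interleaving an honest regularisation with its
own offset copy has no full-sequence continuum limit (ideator 2, card (A)) — so it is kept here as NEGATIVE
knowledge ("keep-reg is not a line"); every line subsequences, and the hereditary form of the pin it must
route through is strong (cofinite) chirality ALONG SOME SUBSEQUENCE (`StronglyChiralSubseq`, typed below in
the eventual-Goldstone currency of `DiagonalSpine.ChiralTuning`).
-/

namespace Summit.QuantumFields.QCD.Cruxes.ChiralGluonicCompletion.Sketch

open scoped BigOperators Matrix Topology SchwartzMap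
open MeasureTheory Filter
open Literature.MathematicalPhysics.QuantumFieldTheory Literature.MathematicalPhysics.QuantumLattice
  Literature.Probability.LatticeModels Literature.MathematicalPhysics.AQFT
open Summit.QuantumFields.QCD.Theses

/-! ## §0 The crux, clause by clause -/

variable {Nf : ℕ}

/-- Clause (i): physical branch. -/
def ClauseI (reg : QCDRegularisation Nf) (m : Fin Nf → ℝ) : Prop :=
  ∀ f : Fin Nf, ∀ᶠ k in atTop, -1 < reg.mcrit k + reg.a k * m f / reg.Zm k

/-- Clause (ii): phase-quenched fractional-moment decay of the quark propagator (UPPER). -/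
def ClauseII (reg : QCDRegularisation Nf) (m : Fin Nf → ℝ) : Prop :=
  ∃ s δ C : ℝ, 0 < s ∧ s < 1 ∧ 0 < δ ∧ ∀ᶠ k in atTop, ∀ S : ℕ, reg.L k ≤ S → ∀ (f : Fin Nf) (v : Literature.Probability.LatticeModels.Site 4), v ∈ box 4 S → (∫ U : GaugeConfig 4 (2 * S + 1) (Matrix.specialUnitaryGroup (Fin 3) ℂ), ‖(diracMatrix U fun fl => reg.mcrit k + reg.a k * m fl / reg.Zm k).det‖ * (∑ a : Fin 3, ∑ i : Fin 4, ∑ b : Fin 3, ∑ j : Fin 4, ‖(diracMatrix U fun fl => reg.mcrit k + reg.a k * m fl / reg.Zm k)⁻¹ (quarkEquiv (f, (Torus.proj (2 * S + 1) 0, a, i))) (quarkEquiv (f, (Torus.proj (2 * S + 1) (v), b, j)))‖) ^ s ∂(wilsonMeasure (fundamentalRep (Fin 3)) (reg.β k))) / (∫ U : GaugeConfig 4 (2 * S + 1) (Matrix.specialUnitaryGroup (Fin 3) ℂ), ‖(diracMatrix U fun fl => reg.mcrit k + reg.a k * m fl / reg.Zm k).det‖ ∂(wilsonMeasure (fundamentalRep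 (Fin 3)) (reg.β k))) ≤ C * Real.exp (-(δ * (reg.a k * ‖v‖)))

/-- Clause (iii): the same moments along the time axis are not lattice-small (LOWER). -/
def ClauseIII (reg : QCDRegularisation Nf) (m : Fin Nf → ℝ) : Prop :=
  ∃ s c₀ C₁ p : ℝ, 0 < s ∧ s < 1 ∧ 0 < c₀ ∧ ∀ᶠ k in atTop, ∀ S : ℕ, reg.L k ≤ S → ∀ (f : Fin Nf) (n : ℕ), n ≤ S → c₀ * Real.exp (-(C₁ * (reg.a k * n) + p * Real.log (n + 1))) ≤ (∫ U : GaugeConfig 4 (2 * S + 1) (Matrix.specialUnitaryGroup (Fin 3) ℂ), ‖(diracMatrix U fun fl => reg.mcrit k + reg.a k * m fl / reg.Zm k).det‖ * (∑ a : Fin 3, ∑ i : Fin 4, ∑ b : Fin 3, ∑ j : Fin 4, ‖(diracMatrix U fun fl => reg.mcrit k + reg.a k * m fl / reg.Zm k)⁻¹ (quarkEquiv (f, (Torus.proj (2 * S + 1) 0, a, i))) (quarkEquiv (f, (Torus.proj (2 * S + 1) (Pi.single 0 (n : ℤ)), b, j)))‖) ^ s ∂(wilsonMeasure (fundamentalRep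 (Fin 3)) (reg.β k))) / (∫ U : GaugeConfig 4 (2 * S + 1) (Matrix.specialUnitaryGroup (Fin 3) ℂ), ‖(diracMatrix U fun fl => reg.mcrit k + reg.a k * m fl / reg.Zm k).det‖ ∂(wilsonMeasure (fundamentalRep (Fin 3)) (reg.β k)))

/-- Clause (iv): sign coherence at the scheme's own side `2L_k+1`. -/
def ClauseIV (reg : QCDRegularisation Nf) (m : Fin Nf → ℝ) : Prop :=
  ∀ᶠ k in atTop, (1 / 2 : ℝ) ≤ ‖∫ U : GaugeConfig 4 (2 * reg.L k + 1) (Matrix.specialUnitaryGroup (Fin 3) ℂ), (diracMatrix U fun fl => reg.mcrit k + reg.a k * m fl / reg.Zm k).det ∂(wilsonMeasure (fundamentalRep (Fin 3)) (reg.β k))‖ / (∫ U : GaugeConfig 4 (2 * reg.L k + 1) (Matrix.specialUnitaryGroup (Fin 3) ℂ), ‖(diracMatrix U fun fl => reg.mcrit k + reg.a k * m fl / reg.Zm k).det‖ ∂(wilsonMeasure (fundamentalRep (Fin 3)) (reg.β k)))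

/-- The conclusion of `PhaseQuenchedFlavourDecay` for `(reg, m)` (flavour-charged phase-quenched decay). -/
def PQFD (reg : QCDRegularisation Nf) (m : Fin Nf → ℝ) : Prop :=
  ∃ δ' : ℝ, 0 < δ' ∧ ∀ (R R' : ℕ) (A : QCDLatticeObservable Nf R) (B : QCDLatticeObservable Nf R'), (∃ (f₀ : Fin Nf) (q : ℤ), q ≠ 0 ∧ ∀ (θ : ℝ) (U : LGConfig 4 (Matrix.specialUnitaryGroup (Fin 3) ℂ)), ExteriorAlgebra.map (LinearMap.pi fun w => (Sum.elim (fun i => if (boxQuarkEquiv.symm i).1 = f₀ then Complex.exp (-((θ : ℂ) * Complex.I)) else 1) (fun i => if (boxQuarkEquiv.symm i).1 = f₀ then Complex.exp ((θ : ℂ) * Complex.I) else 1) (ofLex w)) • LinearMap.proj w) (A.F U) = Complex.exp (((q : ℝ) * θ : ℝ) * Complex.I) • A.F U) → ∃ C' : ℝ, ∀ᶠ k in atTop, ∀ S : ℕ, reg.L k ≤ S → ∀ n : ℕ, n ≤ S → ‖(∫ U : GaugeConfig 4 (2 * S + 1) (Matrix.specialUnitaryGroup (Fin 3) ℂ), (‖(diracMatrix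 U fun fl => reg.mcrit k + reg.a k * m fl / reg.Zm k).det‖ : ℂ) * (fermiIntegral (A.onTorus (2 * S + 1) 0 U * B.onTorus (2 * S + 1) (Pi.single 0 (n : ℤ)) U * fermiBoltzmann U fun fl => reg.mcrit k + reg.a k * m fl / reg.Zm k) / fermiIntegral (fermiBoltzmann U fun fl => reg.mcrit k + reg.a k * m fl / reg.Zm k)) ∂(wilsonMeasure (fundamentalRep (Fin 3)) (reg.β k))) / (∫ U : GaugeConfig 4 (2 * S + 1) (Matrix.specialUnitaryGroup (Fin 3) ℂ), (‖(diracMatrix U fun fl => reg.mcrit k + reg.a k * m fl / reg.Zm k).det‖ : ℂ) ∂(wilsonMeasure (fundamentalRep (Fin 3)) (reg.β k)))‖ ≤ C' * Real.exp (-(δ' * (reg.a k * n)))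

/-- The per-mass package `((i) ∧ (ii) ∧ (iii) ∧ (iv)) ∧ PQFD`. -/
def PerMass (reg : QCDRegularisation Nf) (m : Fin Nf → ℝ) : Prop :=
  (ClauseI reg m ∧ ClauseII reg m ∧ ClauseIII reg m ∧ ClauseIV reg m) ∧ PQFD reg m

variable (Nf) in
/-- **The hypothesis BODY of the crux for one regularisation** (the chirality pin INCLUDED):
`HasMassScaling ∧ IsChiralAtZero ∧ HasAsymptoticScaling ∧ ∀ m > 0, PerMass`. -/
def HypBody (reg : QCDRegularisation Nf) : Prop :=
  reg.HasMassScaling ∧ reg.IsChiralAtZero ∧ (reg.scheme 0 0 0).HasAsymptoticScaling ∧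
    ∀ m : Fin Nf → ℝ, (∀ f, 0 < m f) → PerMass reg m

/-- **The packaging is faithful**: the crux is, definitionally,
`∀ N_f ∈ {2,3}, (∃ reg, HypBody N_f reg) → QCDOf N_f`. -/
theorem crux_iff :
    PauliWegnerSea.ChiralGluonicCompletion ↔
      ∀ Nf : ℕ, Nf = 2 ∨ Nf = 3 → (∃ reg : QCDRegularisation Nf, HypBody Nf reg) → QCDOf Nf :=
  Iff.rfl

/-- The two route copies of the crux are the same term. -/
theorem eq_wilsonMobilityGap :
    PauliWegnerSea.ChiralGluonicCompletion = WilsonMobilityGap.ChiralGluonicCompletion := rfl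

/-! ## §1 Card `parity-reads-intensity` — first lemma

The sign of the Wilson determinant is `σ = (−1)^N` with `N` the number of sub-valence real modes
(tree `fermionDet_wilsonDirac_eq_sign_mul`). If `σ` factors as a product of `M` block parities which are
exchangeable (torus translations) and approximately independent (factorisation defect `η`), then clause
(iv), `E σ ≥ ½`, forces the block defect probability to be `≤ log(1/(½−η)) / (2M)`: at the scheme's own
side the number of physical blocks `M_k → ∞`, so sign defects are LOCALLY RARE — the input the
finite-sign-budget line had to postulate. The abstract inequality: -/

/-- **Parity–intensity inequality (independent form).** If `0 ≤ p_i ≤ ½` and `t ≤ ∏ (1 − 2 p_i)` with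
`0 < t`, then `∑ p_i ≤ ½ log (1/t)`. (With `t = ½ − η` this is the form consumed by the card.) -/
theorem sum_le_half_log_of_le_prod {ι : Type*} (s : Finset ι) (p : ι → ℝ) (t : ℝ) (ht : 0 < t)
    (hp0 : ∀ i ∈ s, 0 ≤ p i) (hp1 : ∀ i ∈ s, p i < 1 / 2) (h : t ≤ ∏ i ∈ s, (1 - 2 * p i)) :
    ∑ i ∈ s, p i ≤ (1 / 2) * Real.log (1 / t) := by
  have hpos : ∀ i ∈ s, 0 < 1 - 2 * p i := fun i hi => by have := hp1 i hi; linarith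
  have hlog : Real.log t ≤ ∑ i ∈ s, Real.log (1 - 2 * p i) := by
    rw [← Real.log_prod fun i hi => (hpos i hi).ne']
    exact Real.log_le_log ht h
  have hterm : ∀ i ∈ s, Real.log (1 - 2 * p i) ≤ -(2 * p i) := fun i hi => by
    have := Real.log_le_sub_one_of_pos (hpos i hi)
    linarith
  have hsum : ∑ i ∈ s, Real.log (1 - 2 * p i) ≤ ∑ i ∈ s, (-(2 * p i)) := Finset.sum_le_sum hterm
  rw [Finset.sum_neg_distrib, ← Finset.mul_sum] at hsum
  have : Real.log (1 / t) = -Real.log t := by rw [one_div, Real.log_inv]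
  rw [this]
  linarith

/-- **Exchangeable form.** If all `M` block probabilities equal `p ∈ [0, ½)` and
`t ≤ (1 − 2p)^M`, `0 < t`, then `p ≤ log(1/t) / (2M)`: the block defect probability is `O(1/M)`. -/
theorem le_log_div_of_le_pow (M : ℕ) (hM : 0 < M) (p t : ℝ) (ht : 0 < t) (hp0 : 0 ≤ p)
    (hp1 : p < 1 / 2) (h : t ≤ (1 - 2 * p) ^ M) : p ≤ Real.log (1 / t) / (2 * M) := by
  have key := sum_le_half_log_of_le_prod (Finset.range M) (fun _ => p) t ht (fun _ _ => hp0)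
    (fun _ _ => hp1) (by simpa using h)
  simp only [Finset.sum_const, Finset.card_range, nsmul_eq_mul] at key
  have hM' : (0 : ℝ) < M := by exact_mod_cast hM
  rw [le_div_iff₀ (by positivity)]
  linarith

/-- **Typed application (statement only): clause (iv) reads the sign-defect intensity.** On the torus of
side `S` at coupling `β` and bare masses `mq`, suppose the sign of the Wilson determinant is the product of
`M` block parities `s i : U ↦ ±1` (defect LOCALITY, to be supplied from clause (ii) / HJL admissibility),
which are EXCHANGEABLE under the phase-quenched law `|det| dμ_W` (torus translations) and factorise up
to `η` (MIXING of the phase-quenched law for local gauge functionals at one physical scale — the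
Yang–Mills-type input, stated honestly). Then `½ ≤ ‖∫det‖/∫|det|` forces the phase-quenched probability
of a block defect to be `≤ log(1/(½−η))/(2M)` — or, in the mirror branch allowed by the NORM in clause
(iv) (`∫ det < 0`, `M` odd), its complement is: `min(p, 1−p) ≤ log(1/(½−η))/(2M)`. At the scheme's own
side `2L_k+1` the block count is `M_k ≍ ((2L_k+1)a_k/ℓ)⁴ → ∞`, so the odd-defect intensity per physical
4-volume is `O(1/V_k)` (the mirror branch dies at the next coarser block scale, or by `0 < ∫ det`). -/
def ParityReadsIntensity : Prop :=
  ∀ (Nf S M : ℕ) [NeZero S] (β : ℝ) (mq : Fin Nf → ℝ)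
    (s : Fin M → GaugeConfig 4 S (Matrix.specialUnitaryGroup (Fin 3) ℂ) → ℝ) (η : ℝ),
    0 < M → 0 ≤ η → η < 1 / 2 →
    (∀ i, Measurable (s i)) → (∀ i U, s i U = 1 ∨ s i U = -1) →
    let μW : Measure (GaugeConfig 4 S (Matrix.specialUnitaryGroup (Fin 3) ℂ)) :=
      wilsonMeasure (fundamentalRep (Fin 3)) β
    let w : GaugeConfig 4 S (Matrix.specialUnitaryGroup (Fin 3) ℂ) → ℝ := fun U => ‖(diracMatrix U mq).det‖
    let Z : ℝ := ∫ U, w U ∂μW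
    let P : (GaugeConfig 4 S (Matrix.specialUnitaryGroup (Fin 3) ℂ) → ℝ) → ℝ := fun F => (∫ U, F U * w U ∂μW) / Z
    -- (a) the sign is the product of the block parities (phase-quenched-a.e.: where `det ≠ 0`)
    (∀ U, (diracMatrix U mq).det ≠ 0 →
        ((diracMatrix U mq).det / (‖(diracMatrix U mq).det‖ : ℂ)) = ((∏ i, s i U : ℝ) : ℂ)) →
    -- (b) exchangeability of the block defect probabilities
    (∀ i j, P (fun U => if s i U = -1 then 1 else 0) = P (fun U => if s j U = -1 then 1 else 0)) →
    -- (c) factorisation defect `η`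
    |P (fun U => ∏ i, s i U) - ∏ i, P (s i)| ≤ η →
    -- clause (iv) at this torus
    (1 / 2 : ℝ) ≤ ‖∫ U, (diracMatrix U mq).det ∂μW‖ / Z →
      -- dichotomy: defects are rare in every block, or (odd `M`, negative `∫ det`) ubiquitous in every block;
      -- the second branch is excluded by `0 < ∫ det` (reflection positivity of the signed theory) or at the
      -- next coarser block scale, and is kept here because clause (iv) is stated with a norm.
      ∀ i, P (fun U => if s i U = -1 then 1 else 0) ≤ Real.log (1 / (1 / 2 - η)) / (2 * M) ∨
        1 - P (fun U => if s i U = -1 then 1 else 0) ≤ Real.log (1 / (1 / 2 - η)) / (2 * M)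

/-! ## §2 The pin under `reg' = reg` and under subsequences (card `keep-k-whole`, merged into `strongly-chiral-subsequence`)

The conclusion `QCDOf N_f` is `∃ reg', HasMassScaling ∧ IsChiralAtZero ∧ ∀ m > 0, ∃ z shift T, …` with
`IsQCDAlong` a FULL-SEQUENCE `Tendsto` along `reg'`. Taking `reg' := reg` the pin and the scaling side
conditions are inherited by `rfl` (`of_sameRegChiralCompletion`) — but the required full-sequence
convergence FAILS for interleaved witnesses (an honest `reg⁰` on even `k`, its offset copy
`m_crit + a_k c/Z_m` on odd `k`: all of H holds, the pin holds along the evens, the even/odd lattice theories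
have different continuum limits), so `SameRegChiralCompletion` below is FALSE in general and keep-`reg` is
not a line. NEGATIVE KNOWLEDGE, kept deliberately. -/

variable (Nf) in
/-- **Same-`reg`, whole-sequence completion — FALSE IN GENERAL (interleaved witnesses), recorded as the
precise statement that keep-`reg` would need.** For every regularisation carrying the hypothesis body and
every positive mass tuple separately: species renormalisations and OS data with full-sequence convergence of
the honest lattice `n`-point functions, the non-degeneracy clauses, a continuum gap and the signed lattice gap
— along `reg` itself. -/
def SameRegChiralCompletion : Prop :=
  ∀ reg : QCDRegularisation Nf, HypBody Nf reg →
    ∀ m : Fin Nf → ℝ, (∀ f, 0 < m f) → ∃ (z shift : QCDField Nf → ℕ → ℝ) (T : OSData (QCDField Nf) 4),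
      (∀ n : ℕ, n ≠ 0 → ∀ (σ : Fin n → QCDField Nf) (f : Fin n → 𝓢(EuclideanSpace ℝ (Fin 4), ℝ))
          (F : 𝓢((Fin n → EuclideanSpace ℝ (Fin 4)), ℂ)), IsTensorOf F (fun i => ofRealTest (f i)) →
            IsOffDiagonal F →
              Tendsto (fun k : ℕ => qcdLatticeSchwinger (reg.scheme m z shift) k n σ f) atTop
                (𝓝 (T.schwinger n σ F))) ∧
        T.IsNontrivial QCDField.glue ∧ T.IsNonGaussian QCDField.glue ∧
          (∀ f g : Fin Nf, f ≠ g → T.IsNontrivial (QCDField.pseudoRe f g)) ∧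
            ∃ Δ > 0, T.HasMassGap Δ ∧ (reg.scheme m z shift).HasLatticeMassGap Δ

/-- Keep-`reg` WOULD close the crux by one application (the pin travels by `rfl`); true implication,
unusable because its hypothesis is false in general (see above). (Proved; axioms standard.) -/
theorem of_sameRegChiralCompletion (h : ∀ Nf : ℕ, Nf = 2 ∨ Nf = 3 → SameRegChiralCompletion Nf) :
    PauliWegnerSea.ChiralGluonicCompletion := by
  rw [crux_iff]
  rintro Nf hNf ⟨reg, hreg⟩
  obtain ⟨hMS, hCh, hAS, hper⟩ := hreg
  refine ⟨reg, hMS, hCh, fun m hm => ?_⟩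
  obtain ⟨z, shift, T, hconv, hN, hG, hP, hΔ⟩ := h Nf hNf reg ⟨hMS, hCh, hAS, hper⟩ m hm
  exact ⟨z, shift, T, ⟨hAS, (hper m hm).1.1, hconv⟩, hN, hG, hP, hΔ⟩

/-- Restriction of a regularisation along a strictly increasing reindexing (the shape of
`DiagonalSpine.SubsequenceStability`). -/
def subseq (reg : QCDRegularisation Nf) (φ : ℕ → ℕ) (hφ : StrictMono φ) : QCDRegularisation Nf where
  a := reg.a ∘ φ
  a_pos k := reg.a_pos (φ k)
  tendsto_a := reg.tendsto_a.comp hφ.tendsto_atTop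
  β := reg.β ∘ φ
  L := reg.L ∘ φ
  tendsto_L := reg.tendsto_L.comp hφ.tendsto_atTop
  mcrit := reg.mcrit ∘ φ
  Zm := reg.Zm ∘ φ
  Zm_pos k := reg.Zm_pos (φ k)

variable (Nf) in
/-- **What every (necessarily subsequencing) line must obtain first (statement only): a STRONGLY chiral
subsequence of the hypothesis' regularisation, in eventual-Goldstone currency.** `IsChiralAtZero` is an
`∃ᶠ k`-type clause, NOT inherited by subsequences; its cofinite form along SOME `StrictMono φ₀` is (the
shape of `DiagonalSpine.ChiralTuning`'s `G` restricted to `φ₀`; ideator 2's `IsStronglyChiralAtZero` /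
`chiral_selection` is the abstract version): for every `ε` a positive mass tuple, a rate `μ < ε`, an
amplitude `c > 0`, ONE pair of local observables and separations `a n → ∞` with `c e^{−μ a n} ≤ ‖corr‖` for
ALL large indices ALONG `φ₀`. (An earlier draft asked this along all of `reg` — false for interleaved /
fragmented witnesses; the `∃ φ₀` is essential, and for fragmented witnesses with infinitely many offset
components `M_j ↓ 0` the subsequence is necessarily cross-component, so manufacturing it needs Goldstone
lower bounds LOCALLY UNIFORM in the mass.) -/
def StronglyChiralSubseq : Prop :=
  ∀ reg : QCDRegularisation Nf, HypBody Nf reg → ∃ (φ₀ : ℕ → ℕ) (hφ₀ : StrictMono φ₀),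
    ∀ ε > (0 : ℝ), ∃ m : Fin Nf → ℝ, (∀ f, 0 < m f) ∧ ∃ μ c : ℝ, μ < ε ∧ 0 < c ∧
      ∃ (R R' : ℕ) (A : QCDLatticeObservable Nf R) (B : QCDLatticeObservable Nf R') (S n : ℕ → ℕ),
        (∀ t, (subseq reg φ₀ hφ₀).L t ≤ S t) ∧ (∀ t, n t ≤ S t) ∧
          Tendsto (fun t => (subseq reg φ₀ hφ₀).a t * n t) atTop atTop ∧
          ∀ᶠ t in atTop, c * Real.exp (-(μ * ((subseq reg φ₀ hφ₀).a t * n t))) ≤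
            ‖qcdLatticeConnectedCorr ((subseq reg φ₀ hφ₀).β t) (2 * S t + 1)
              (fun fl => ((subseq reg φ₀ hφ₀).scheme m 0 0).mq fl t) A B (n t)‖

/-- **The eventual bound survives further subsequences and implies the pin** (statement; the general case
is `DiagonalSpine.GoldstonePersistence`, provable now): along every `StrictMono φ`, the restricted
regularisation is chiral at zero. This is what makes the compactness step legal once it is routed through a
strongly chiral `φ₀`. -/
def EventualGoldstonePersists : Prop :=
  ∀ (reg : QCDRegularisation Nf) (φ : ℕ → ℕ) (hφ : StrictMono φ),
    (∀ ε > (0 : ℝ), ∃ m : Fin Nf → ℝ, (∀ f, 0 < m f) ∧ ∃ μ c : ℝ, μ < ε ∧ 0 < c ∧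
      ∃ (R R' : ℕ) (A : QCDLatticeObservable Nf R) (B : QCDLatticeObservable Nf R') (S n : ℕ → ℕ),
        (∀ k, reg.L k ≤ S k) ∧ (∀ k, n k ≤ S k) ∧ Tendsto (fun k => reg.a k * n k) atTop atTop ∧
          ∀ᶠ k in atTop, c * Real.exp (-(μ * (reg.a k * n k))) ≤
            ‖qcdLatticeConnectedCorr (reg.β k) (2 * S k + 1) (fun fl => (reg.scheme m 0 0).mq fl k) A B (n k)‖) →
    (subseq reg φ hφ).IsChiralAtZero

/-- The logical core of the fragmentation caveat, in one line: a `∃ᶠ`-property of a sequence need not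
survive a subsequence. (Instance: `P k := Even k`, `φ k := 2k+1`.) -/
theorem frequently_not_subseq_stable :
    ∃ (P : ℕ → Prop) (φ : ℕ → ℕ), StrictMono φ ∧ (∃ᶠ k in atTop, P k) ∧ ¬ ∃ᶠ k in atTop, P (φ k) := by
  refine ⟨fun k => Even k, fun k => 2 * k + 1, fun a b h => by dsimp; omega, ?_, ?_⟩
  · exact Filter.frequently_atTop.mpr fun a => ⟨2 * a, by omega, even_two_mul a⟩
  · rw [Filter.not_frequently]
    exact Filter.Eventually.of_forall fun k h => (Nat.even_add_one.mp h) (even_two_mul k)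

/-! ## §3 Card `pointwise-suffices` — mass openness closes the `∀ m` hole from pointwise data

F3 (9152 FINDINGS): H's constants are pointwise in `m`, the conclusion needs ONE index set for all `m`, and
Baire category alone gives uniformity only on a dense open set of masses. The card's lever: the honest
torus functional at bare masses `m'` is the one at `m` reweighted by the `U`-INDEPENDENT Grassmann factor
`exp(−Σ_f δ_f ψ̄_f ψ_f)`, `δ_f = a_k (m'_f − m_f)/Z_m(k)` — in renormalised terms the perturbation
`Δm · ∫ S_R` with a FREE small parameter `Δm` — so clustering at the single point `m` (the core, in
Kotecký–Preiss-margin form) propagates to a neighbourhood of `m` by a convergent expansion: the set of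
masses with given constants is OPEN, pointwise becomes locally uniform, and compactness + Lindelöf need only
countably many centres. -/

/-- **Mass-shift factorisation of the fermionic Boltzmann factor** (statement; provable now from
`quadratic_add`, `grassmannExp_add`, evenness/nilpotency of quadratic elements and
`wilsonDirac_mass_eq_add_scalar`): changing the bare masses multiplies `exp(−ψ̄ D(U,m) ψ)` by the
`U`-independent factor `exp(−ψ̄ (D(U,m') − D(U,m)) ψ) = exp(−Σ_f (m'_f − m_f) ψ̄_f ψ_f)`. -/
def MassShiftFactorisation : Prop :=
  ∀ (Nf S : ℕ) [NeZero S] (U : GaugeConfig 4 S (Matrix.specialUnitaryGroup (Fin 3) ℂ)) (mq mq' : Fin Nf → ℝ),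
    fermiBoltzmann U mq' =
      grassmannExp (quadratic ℂ (-(diracMatrix U mq' - diracMatrix U mq))) * fermiBoltzmann U mq

/-- **Mass-shift reweighting identity for the honest torus functional** (statement; from the factorisation
and `qcdTorusExpect`'s definition, valid where the signed partition function at `mq` is non-zero — clause
(iv) gives that at the scheme side, `fermiDenominator_ne_zero_of_ratio`): with
`E := exp(−ψ̄ (D(·,m') − D(·,m)) ψ)` (configuration-independent as a function of the bare-mass shift),
`⟨X⟩_{m'} = ⟨X · E⟩_m / ⟨E⟩_m`. The free small parameter of the card is `m' − m`. -/
def MassShiftIdentity : Prop :=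
  ∀ (Nf S : ℕ) [NeZero S] (β : ℝ) (mq mq' : Fin Nf → ℝ)
    (X : GaugeConfig 4 S (Matrix.specialUnitaryGroup (Fin 3) ℂ) → FermiAlg Nf S),
    (∫ U : GaugeConfig 4 S (Matrix.specialUnitaryGroup (Fin 3) ℂ), fermiIntegral (fermiBoltzmann U mq)
        ∂(wilsonMeasure (fundamentalRep (Fin 3)) β)) ≠ 0 →
    let E : GaugeConfig 4 S (Matrix.specialUnitaryGroup (Fin 3) ℂ) → FermiAlg Nf S :=
      fun U => grassmannExp (quadratic ℂ (-(diracMatrix U mq' - diracMatrix U mq)))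
    qcdTorusExpect β S mq' X = qcdTorusExpect β S mq (fun U => X U * E U) / qcdTorusExpect β S mq E

variable (Nf) in
/-- **Local mass-Lipschitz bound at a point** (the OUTPUT shape of mass openness for one regularisation, one
centre `m`, radius `r`, constant `Lip`): honest connected Euclidean-time correlators of every pair of local
observables, at every large `k`, on every torus `S ≥ L_k` and every separation, are `Lip`-Lipschitz in the
renormalised masses ON THE BALL of radius `r` about `m` (two-point form — the centre-only form would not
give equicontinuity; analyticity on the ball, which is what the expansion yields, gives this by Cauchy
estimates on a smaller ball). (What the card's stub `MassOpenness`
delivers from the core AT `m` alone; typed here so that the covering step below is checkable.) -/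
def MassLocalLipschitz (reg : QCDRegularisation Nf) (m : Fin Nf → ℝ) (r Lip : ℝ) : Prop :=
  ∀ (R R' : ℕ) (A : QCDLatticeObservable Nf R) (B : QCDLatticeObservable Nf R'),
    ∀ᶠ k in atTop, ∀ S : ℕ, reg.L k ≤ S → ∀ n : ℕ, n ≤ S →
      ∀ m' m'' : Fin Nf → ℝ, dist m' m < r → dist m'' m < r →
        ‖qcdLatticeConnectedCorr (reg.β k) (2 * S + 1) (fun fl => (reg.scheme m' 0 0).mq fl k) A B n -
            qcdLatticeConnectedCorr (reg.β k) (2 * S + 1) (fun fl => (reg.scheme m'' 0 0).mq fl k) A B n‖ ≤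
          Lip * dist m' m''

variable (Nf) in
/-- **Pointwise suffices (the covering step; provable now: Lebesgue number of the cover of `K` by the
balls, finite subcover, max of the finitely many eventual thresholds):** if every
positive mass tuple is the centre of SOME ball with a local mass-Lipschitz bound, then on every compact set
of positive tuples the honest correlators are equicontinuous in the mass UNIFORMLY in `k` (eventually), `S`
and `n` — the equicontinuity hypothesis of `DiagonalSpine.DiagonalLemma` for these data, obtained without any
`m`-uniformity in the hypothesis package. -/
def PointwiseSuffices : Prop :=
  ∀ reg : QCDRegularisation Nf,
    (∀ m : Fin Nf → ℝ, (∀ f, 0 < m f) → ∃ r Lip : ℝ, 0 < r ∧ MassLocalLipschitz Nf reg m r Lip) →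
      ∀ K : Set (Fin Nf → ℝ), IsCompact K → K ⊆ {m | ∀ f, 0 < m f} →
        ∀ (R R' : ℕ) (A : QCDLatticeObservable Nf R) (B : QCDLatticeObservable Nf R'),
          ∀ ε > (0 : ℝ), ∃ δ > (0 : ℝ), ∀ᶠ k in atTop, ∀ S : ℕ, reg.L k ≤ S → ∀ n : ℕ, n ≤ S →
            ∀ m ∈ K, ∀ m' ∈ K, dist m' m < δ →
              ‖qcdLatticeConnectedCorr (reg.β k) (2 * S + 1) (fun fl => (reg.scheme m' 0 0).mq fl k) A B n -
                  qcdLatticeConnectedCorr (reg.β k) (2 * S + 1) (fun fl => (reg.scheme m 0 0).mq fl k) A B n‖ < ε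

end Summit.QuantumFields.QCD.Cruxes.ChiralGluonicCompletion.Sketch
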